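import Mathlib
import HarnessLib
import Summits.CriticalPhenomena.PercolationContinuityZ3.Statement
import Summits.CriticalPhenomena.PercolationContinuityZ3.Theorems.PercTreeValueTetrahedronDisjointCoexistenceStubRestrictProduct
import Literature.Probability.Percolation.ConnectivityThetaSqProofs
import Literature.Probability.Percolation.CriticalContinuity
import Literature.Probability.Percolation.InequalitiesProofs
import Literature.Probability.Percolation.PercolationProofs
import Literature.Probability.Percolation.Crossings

/-!
# Route PercTreeValue, crux `TetrahedronHarrisGap` (stmt-CriticalPhenomena-7799), line `SketchIdeator1` rev 7:
# RESTRICTED GLUING HOLDS IN EVERY JUMP WORLD (the new open input is world-neutral, formally)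

Lead prover-line-stmt-CriticalPhenomena-7799-c3-0 (continuation c3).  The rev-7 composition (`stub_cruxOfCollar`, landed) reduces the crux to
X_B (stmt-0846) ∧ BoxRestriction (7798's S5') ∧ RESTRICTED GLUING
(`stub_restrictedGluing`: `c · P(W_r) ≤ P(W_r ∩ {0 ↔ b_r})`, `W_r = {0 ↔ a_r in R_r} ∩ {b_r ↔ c_r in U_r}`).
This file records that the gluing input carries NO continuity content: if `θ(p_c(ℤ³)) > 0` then it holds with `c = θ(p_c)²` and
`r₀ = 0`, because `W_r` and `{0 ↔ b_r}` are increasing, so Harris–FKG and `τ ≥ θ²` (Grimmett 1999 §8.5, `Grimmett1999_theta_sq_le_openConn_holds`)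
give `θ² P(W_r) ≤ P(0↔b_r) P(W_r) ≤ P(W_r ∩ {0↔b_r})`.  Consequently `¬ RestrictedGluing ⇒ θ(p_c) = 0`: a refutation of the stub would
itself settle the conjunct (`percolationContinuityZ3_of_not_restrictedGluing`), and the disjunction
`restrictedGluing_or_percolationContinuityZ3` holds unconditionally.

* `stub_restrictedGluing_of_theta_pos` — registered transfer (hypothesis `0 < θ(p_c)`), the registered text of `stub_restrictedGluing` as conclusion;
* `percolationContinuityZ3_of_not_restrictedGluing`, `restrictedGluing_or_percolationContinuityZ3` — corollaries.
-/

noncomputable section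

namespace Summit.CriticalPhenomena.PercolationContinuityZ3.Theorems.TetrahedronHarrisGap

open MeasureTheory
open Literature.Probability.Percolation Literature.Probability.LatticeModels
open Summit.CriticalPhenomena.PercolationContinuityZ3.Theorems.TetrahedronDisjointCoexistence

/-- **Restricted gluing in a jump world** (registered transfer `stub_restrictedGluing_of_theta_pos` of line `SketchIdeator1`, rev 7):
if `θ(p_c(ℤ³)) > 0` then `θ(p_c)² · P(W_r) ≤ P(W_r ∩ {0 ↔ b_r})` for every `r` — Harris–FKG for the increasing events `W_r`, `{0 ↔ b_r}`
and `τ_{p_c}(0, b_r) ≥ θ(p_c)²`. -/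
theorem stub_restrictedGluing_of_theta_pos
    (hθ : 0 < theta (zdGraph 3) (0 : Site 3) (criticalProbI 3)) :
    ∃ c : ℝ, 0 < c ∧ ∃ r₀ : ℕ, ∀ r : ℕ, r₀ ≤ r →
      c * (bondPercolation (zdGraph 3) (criticalProbI 3)).real
          (openConnIn
              {x : Site 3 | -(r : ℤ) ≤ x 0 ∧ x 0 ≤ 2 * (r : ℤ) ∧ -(r : ℤ) ≤ x 1 ∧ x 1 ≤ 2 * (r : ℤ) ∧
                -(2 * (r : ℤ)) ≤ x 2 ∧ x 2 ≤ 3 * ((r : ℤ) / 8)}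
              (0 : Site 3) ![(r : ℤ), (r : ℤ), 0] ∩
            openConnIn {x : Site 3 | (r : ℤ) - 3 * ((r : ℤ) / 8) ≤ x 2}
              (![(r : ℤ), 0, (r : ℤ)] : Site 3) ![0, (r : ℤ), (r : ℤ)]) ≤
        (bondPercolation (zdGraph 3) (criticalProbI 3)).real
          (openConnIn
              {x : Site 3 | -(r : ℤ) ≤ x 0 ∧ x 0 ≤ 2 * (r : ℤ) ∧ -(r : ℤ) ≤ x 1 ∧ x 1 ≤ 2 * (r : ℤ) ∧
                -(2 * (r : ℤ)) ≤ x 2 ∧ x 2 ≤ 3 * ((r : ℤ) / 8)}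
              (0 : Site 3) ![(r : ℤ), (r : ℤ), 0] ∩
            openConnIn {x : Site 3 | (r : ℤ) - 3 * ((r : ℤ) / 8) ≤ x 2}
              (![(r : ℤ), 0, (r : ℤ)] : Site 3) ![0, (r : ℤ), (r : ℤ)] ∩
            openConn (0 : Site 3) ![(r : ℤ), 0, (r : ℤ)]) := by
  refine ⟨theta (zdGraph 3) (0 : Site 3) (criticalProbI 3) ^ 2, by positivity, 0, fun r _ => ?_⟩
  set R : Set (Site 3) :=
    {x : Site 3 | -(r : ℤ) ≤ x 0 ∧ x 0 ≤ 2 * (r : ℤ) ∧ -(r : ℤ) ≤ x 1 ∧ x 1 ≤ 2 * (r : ℤ) ∧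
      -(2 * (r : ℤ)) ≤ x 2 ∧ x 2 ≤ 3 * ((r : ℤ) / 8)} with hR_def
  set U : Set (Site 3) := {x : Site 3 | (r : ℤ) - 3 * ((r : ℤ) / 8) ≤ x 2} with hU_def
  set W : Set (BondConfig (Site 3)) :=
    openConnIn R (0 : Site 3) ![(r : ℤ), (r : ℤ), 0] ∩
      openConnIn U (![(r : ℤ), 0, (r : ℤ)] : Site 3) ![0, (r : ℤ), (r : ℤ)] with hW_def
  set B : Set (BondConfig (Site 3)) := openConn (0 : Site 3) ![(r : ℤ), 0, (r : ℤ)] with hB_def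
  have hWu : IsUpperSet W :=
    (isUpperSet_openConnIn R (0 : Site 3) _).inter (isUpperSet_openConnIn U _ _)
  have hWm : MeasurableSet W :=
    (restrictProduct_measurableSet_openConnIn R (0 : Site 3) _).inter (restrictProduct_measurableSet_openConnIn U _ _)
  have hBu : IsUpperSet B := isUpperSet_openConn _ _
  have hBm : MeasurableSet B := measurableSet_openConn_holds _ _
  -- Harris–FKG and `τ ≥ θ²`
  have hH : (bondPercolation (zdGraph 3) (criticalProbI 3)).real W *
      (bondPercolation (zdGraph 3) (criticalProbI 3)).real B ≤
      (bondPercolation (zdGraph 3) (criticalProbI 3)).real (W ∩ B) :=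
    harris_fkg_holds (zdGraph 3) (criticalProbI 3) hWu hBu hWm hBm
  have hτ : theta (zdGraph 3) (0 : Site 3) (criticalProbI 3) ^ 2 ≤ (bondPercolation (zdGraph 3) (criticalProbI 3)).real B :=
    Grimmett1999_theta_sq_le_openConn_holds 3 (criticalProbI 3) (0 : Site 3) ![(r : ℤ), 0, (r : ℤ)]
  have hWnn : 0 ≤ (bondPercolation (zdGraph 3) (criticalProbI 3)).real W := measureReal_nonneg
  calc theta (zdGraph 3) (0 : Site 3) (criticalProbI 3) ^ 2 * (bondPercolation (zdGraph 3) (criticalProbI 3)).real W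
      ≤ (bondPercolation (zdGraph 3) (criticalProbI 3)).real B * (bondPercolation (zdGraph 3) (criticalProbI 3)).real W :=
        mul_le_mul_of_nonneg_right hτ hWnn
    _ = (bondPercolation (zdGraph 3) (criticalProbI 3)).real W * (bondPercolation (zdGraph 3) (criticalProbI 3)).real B := mul_comm _ _
    _ ≤ (bondPercolation (zdGraph 3) (criticalProbI 3)).real (W ∩ B) := hH

/-- **`¬` RestrictedGluing ⟹ `θ(p_c(ℤ³)) = 0`**: a refutation of the rev-7 gluing input would settle the conjunct by itself
(contrapositive of `stub_restrictedGluing_of_theta_pos`; `θ ≥ 0`). -/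
theorem percolationContinuityZ3_of_not_restrictedGluing
    (hNot : ¬ ∃ c : ℝ, 0 < c ∧ ∃ r₀ : ℕ, ∀ r : ℕ, r₀ ≤ r →
      c * (bondPercolation (zdGraph 3) (criticalProbI 3)).real
          (openConnIn
              {x : Site 3 | -(r : ℤ) ≤ x 0 ∧ x 0 ≤ 2 * (r : ℤ) ∧ -(r : ℤ) ≤ x 1 ∧ x 1 ≤ 2 * (r : ℤ) ∧
                -(2 * (r : ℤ)) ≤ x 2 ∧ x 2 ≤ 3 * ((r : ℤ) / 8)}
              (0 : Site 3) ![(r : ℤ), (r : ℤ), 0] ∩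
            openConnIn {x : Site 3 | (r : ℤ) - 3 * ((r : ℤ) / 8) ≤ x 2}
              (![(r : ℤ), 0, (r : ℤ)] : Site 3) ![0, (r : ℤ), (r : ℤ)]) ≤
        (bondPercolation (zdGraph 3) (criticalProbI 3)).real
          (openConnIn
              {x : Site 3 | -(r : ℤ) ≤ x 0 ∧ x 0 ≤ 2 * (r : ℤ) ∧ -(r : ℤ) ≤ x 1 ∧ x 1 ≤ 2 * (r : ℤ) ∧
                -(2 * (r : ℤ)) ≤ x 2 ∧ x 2 ≤ 3 * ((r : ℤ) / 8)}
              (0 : Site 3) ![(r : ℤ), (r : ℤ), 0] ∩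
            openConnIn {x : Site 3 | (r : ℤ) - 3 * ((r : ℤ) / 8) ≤ x 2}
              (![(r : ℤ), 0, (r : ℤ)] : Site 3) ![0, (r : ℤ), (r : ℤ)] ∩
            openConn (0 : Site 3) ![(r : ℤ), 0, (r : ℤ)])) :
    _root_.PercolationContinuityZ3 := by
  refine Literature.Probability.Percolation.percolationContinuityZ3_iff.mpr ?_
  by_contra hne
  have hθnn : 0 ≤ theta (zdGraph 3) (0 : Site 3) (criticalProbI 3) := by
    unfold theta
    exact measureReal_nonneg
  exact hNot (stub_restrictedGluing_of_theta_pos (lt_of_le_of_ne hθnn (Ne.symm hne)))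

/-- **RestrictedGluing ∨ `θ(p_c(ℤ³)) = 0`**, unconditionally: the rev-7 gluing input is WORLD-NEUTRAL — it can only fail in a world where
the conjunct already holds. -/
theorem restrictedGluing_or_percolationContinuityZ3 :
    (∃ c : ℝ, 0 < c ∧ ∃ r₀ : ℕ, ∀ r : ℕ, r₀ ≤ r →
      c * (bondPercolation (zdGraph 3) (criticalProbI 3)).real
          (openConnIn
              {x : Site 3 | -(r : ℤ) ≤ x 0 ∧ x 0 ≤ 2 * (r : ℤ) ∧ -(r : ℤ) ≤ x 1 ∧ x 1 ≤ 2 * (r : ℤ) ∧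
                -(2 * (r : ℤ)) ≤ x 2 ∧ x 2 ≤ 3 * ((r : ℤ) / 8)}
              (0 : Site 3) ![(r : ℤ), (r : ℤ), 0] ∩
            openConnIn {x : Site 3 | (r : ℤ) - 3 * ((r : ℤ) / 8) ≤ x 2}
              (![(r : ℤ), 0, (r : ℤ)] : Site 3) ![0, (r : ℤ), (r : ℤ)]) ≤
        (bondPercolation (zdGraph 3) (criticalProbI 3)).real
          (openConnIn
              {x : Site 3 | -(r : ℤ) ≤ x 0 ∧ x 0 ≤ 2 * (r : ℤ) ∧ -(r : ℤ) ≤ x 1 ∧ x 1 ≤ 2 * (r : ℤ) ∧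
                -(2 * (r : ℤ)) ≤ x 2 ∧ x 2 ≤ 3 * ((r : ℤ) / 8)}
              (0 : Site 3) ![(r : ℤ), (r : ℤ), 0] ∩
            openConnIn {x : Site 3 | (r : ℤ) - 3 * ((r : ℤ) / 8) ≤ x 2}
              (![(r : ℤ), 0, (r : ℤ)] : Site 3) ![0, (r : ℤ), (r : ℤ)] ∩
            openConn (0 : Site 3) ![(r : ℤ), 0, (r : ℤ)])) ∨
    _root_.PercolationContinuityZ3 := by
  by_cases h : ∃ c : ℝ, 0 < c ∧ ∃ r₀ : ℕ, ∀ r : ℕ, r₀ ≤ r →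
      c * (bondPercolation (zdGraph 3) (criticalProbI 3)).real
          (openConnIn
              {x : Site 3 | -(r : ℤ) ≤ x 0 ∧ x 0 ≤ 2 * (r : ℤ) ∧ -(r : ℤ) ≤ x 1 ∧ x 1 ≤ 2 * (r : ℤ) ∧
                -(2 * (r : ℤ)) ≤ x 2 ∧ x 2 ≤ 3 * ((r : ℤ) / 8)}
              (0 : Site 3) ![(r : ℤ), (r : ℤ), 0] ∩
            openConnIn {x : Site 3 | (r : ℤ) - 3 * ((r : ℤ) / 8) ≤ x 2}
              (![(r : ℤ), 0, (r : ℤ)] : Site 3) ![0, (r : ℤ), (r : ℤ)]) ≤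
        (bondPercolation (zdGraph 3) (criticalProbI 3)).real
          (openConnIn
              {x : Site 3 | -(r : ℤ) ≤ x 0 ∧ x 0 ≤ 2 * (r : ℤ) ∧ -(r : ℤ) ≤ x 1 ∧ x 1 ≤ 2 * (r : ℤ) ∧
                -(2 * (r : ℤ)) ≤ x 2 ∧ x 2 ≤ 3 * ((r : ℤ) / 8)}
              (0 : Site 3) ![(r : ℤ), (r : ℤ), 0] ∩
            openConnIn {x : Site 3 | (r : ℤ) - 3 * ((r : ℤ) / 8) ≤ x 2}
              (![(r : ℤ), 0, (r : ℤ)] : Site 3) ![0, (r : ℤ), (r : ℤ)] ∩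
            openConn (0 : Site 3) ![(r : ℤ), 0, (r : ℤ)])
  · exact Or.inl h
  · exact Or.inr (percolationContinuityZ3_of_not_restrictedGluing h)

end Summit.CriticalPhenomena.PercolationContinuityZ3.Theorems.TetrahedronHarrisGap

end
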